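/-
Copyright (c) 2026. All rights reserved.
Released under Apache 2.0 license as described in the file LICENSE.
-/
import Literature.AlgebraicGeometry.Pohlmann1968.MultiquadraticCMFieldDegreeSixteenAllPowersHodgeConjecture
import Literature.AlgebraicGeometry.Pohlmann1968.DegenerateCMTypesMultiquadraticCMFieldParity
import Literature.NumberTheory.ComplexMultiplication.DegenerateCMTypesElementaryAbelianStabilizerRank
import HarnessLib

/-!
# Multiquadratic CM fields of every degree: a CM type of rank `5` is induced from a nondegenerate octic type, and the
# Hodge conjecture holds for every power of its abelian varieties

SETTING.  `K` a CM field, Galois over `ℚ` with `Gal(K/ℚ)` of exponent `2` (`K = ℚ(√−d, √a₁, …, √aₙ)`, any `n`), `Φ`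
a CM type, `Rank(Φ)` its Kubota rank (`= dim MT(A)`), `Stab(Φ) = {g ∈ Gal(K/ℚ) : Φg = Φ}` its twist stabiliser.
The field dress of the tree's group-level `DegenerateCMTypesElementaryAbelianStabilizerRank` (seat p10 g38-#8:
on a group of exponent `2` of any order, `rank(T) = 5 ⟹ |G| ≤ 8·|Stab(T)|` — the four surviving odd characters are
`χ₁, χ₂, χ₃, χ₁χ₂χ₃` by Titsworth's relation, and the stabiliser contains `ker χ₁ ∩ ker χ₂ ∩ ker χ₃` — and
`Stab(T) ∋ g ≠ 1 ⟹ rank(T) ≤ |G|/4 + 1`; T. Kubota [Kubota1965] §2, §4 Lemma 2):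

> **Theorem** (`exists_inducedCMType_octic_isNondegenerate_of_cmTypeRank_eq_five`).  If `Rank(Φ) = 5` then
> `[K:ℚ] ≤ 8·|Stab(Φ)|`, and `Φ = Ψ^K` for a NONDEGENERATE CM type `Ψ` of an OCTIC subfield `k` (the fixed field of
> `Stab(Φ)`: `[k:ℚ] ≤ 8`, and `5 = Rank(Ψ) ≤ [k:ℚ]/2 + 1` forces `[k:ℚ] = 8` and full rank).
> **Theorem** (`hodgeConjectureFor_pow_of_cmTypeRank_eq_five`).  If `Rank(Φ) = 5` then for EVERY realisation
> `(A, ι, θ)` of `(K; Φ)` (any polarisation, the action read on `H¹`) and every `n`: `Bᵐ(Aⁿ) ⊗ ℂ = Dᵐ(Aⁿ) ⊗ ℂ`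
> for all `m`, and THE HODGE CONJECTURE HOLDS FOR `Aⁿ` — Pohlmann–Hazama transfer along `Φ = Ψ^K`
> (tree `IsNondegenerate.hodgeClassSpan_pow_eq_divisorClassesSpan_inducedCMType`; B. B. Gordon
> [Gordon1999HodgeAVSurvey] Thm. 6.4, §9.3), `Ψ` nondegenerate (Hazama–Murty).
> **Theorem** (`cmTypeRank_le_of_comp_mem_iff`).  If `Φg = Φ` for some `g ≠ 1` then `Rank(Φ) ≤ [K:ℚ]/4 + 1`; and
> if `Rank(Φ) = 5`, `[K:ℚ] ≥ 16` then `Φ` is not primitive and its abelian varieties are not simple.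

The degrees `16` (tree `MultiquadraticCMFieldDegreeSixteenAllPowersHodgeConjecture`) and `32` (sequel) are the
special cases `[k:K]`-index `2` and `4`.

* §0 `isAbelianGalois_of_forall_sq_eq_one`, `mem_twistStabilizer_of_comp_mem_iff`, the dictionary
  **`comp_mem_iff_iff_forall_mul_mem_iff`** (`Φg = Φ ⟺ tg ∈ S ⟺ t ∈ S` on `S = {t : σ_t ∈ Φ}`),
  `hodgeConjectureFor_of_forall_hodgeClassSpan_eq_divisorClassesSpan`.
* §1 `cmTypeRank_le_of_comp_mem_iff`, `finrank_le_eight_mul_natCard_twistStabilizer_of_cmTypeRank_eq_five`,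
  `finrank_fixedField_twistStabilizer_eq_eight_of_cmTypeRank_eq_five`,
  **`finrank_eq_eight_mul_natCard_twistStabilizer_of_cmTypeRank_eq_five`** (`[K:ℚ] = 8·|Stab(Φ)|`),
  **`exists_inducedCMType_octic_isNondegenerate_of_cmTypeRank_eq_five`**,
  `not_isPrimitive_of_cmTypeRank_eq_five_of_sixteen_le`, `not_isSimple_of_cmTypeRank_eq_five_of_sixteen_le`.
* §2 `hodgeClassSpan_pow_eq_divisorClassesSpan_of_cmTypeRank_eq_five`, **`hodgeConjectureFor_pow_of_cmTypeRank_eq_five`**,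
  `hodgeClasses_algebraic_pow_of_cmTypeRank_eq_five`, `not_exists_exceptional_pow_of_cmTypeRank_eq_five`.

HONEST SCOPE.  Assemblies of tree theorems with the seat's group-level bound; no named fact.  THEOREMS ONLY: no
definition, no named fact, no instance, no `sorry`.

## References

* [Kubota1965] T. Kubota, *On the field extension by complex multiplication*, Trans. AMS 118 (1965), §2, §4 Lemma 2.
* [Gordon1999HodgeAVSurvey] B. B. Gordon, *A survey of the Hodge conjecture for abelian varieties*, Prop. 9.4.1,
  Thm. 6.4, §9.3.
* [Dodson1984] B. Dodson, *The structure of Galois groups of CM-fields*, Trans. AMS 283 (1984), §3.1.1.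
* [Shimura1998] G. Shimura, *Abelian Varieties with Complex Multiplication and Modular Functions*, §8.1, §8.2
  Prop. 26, §8.4 Example (1).
* [BCLLMNO2015] Bouw–Cooley–Lauter–Lorenzo García–Manes–Newton–Ozman, §3 Prop. 3.3 (induced CM types).
* [Lang1983ComplexMultiplication] S. Lang, *Complex Multiplication*, Ch. I Thm. 3.6.
* [Carlet2020] C. Carlet, *Boolean Functions for Cryptography and Coding Theory*, CUP, §2.3 (2.51).

## Provenance

Lane `lit-hodgefound` (Track 2, Layer A4/A5), seat `lit-hodgefound-p10` generation 38, row g38-#9; neighbours cited by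
name, nothing restated: `DegenerateCMTypesElementaryAbelianStabilizerRank`
(`card_le_eight_mul_card_filter_forall_mul_mem_iff_of_typeRank_eq_five`, `typeRank_le_of_forall_mul_mem_iff`,
`exists_ne_one_forall_mul_mem_iff_of_typeRank_eq_five_of_le`), `MultiquadraticCMFieldDegreeSixteenAllPowersHodgeConjecture`
(pattern: the degree-`16` case), `GaloisOcticCMFieldAllPowersHodgeConjecture` (`not_isPrimitive_of_comp_mem_iff`),
`CMTypeEquivalenceClassesCount` (`twistStabilizer`, `mem_twistStabilizer_iff`,
`exists_eq_inducedCMType_fixedField_of_le_twistStabilizer`, `pattern_primitive_iff_twistStabilizer_eq_bot`),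
`CMTypeRankInducedType` (`cmTypeRank_inducedCMType`), `NondegenerateCMTypeDivisorClasses` (`cmTypeRank_le`,
`isNondegenerate_iff`), `NonSimpleCMAbelianVarietyHazamaCriterion`
(`IsNondegenerate.hodgeClassSpan_pow_eq_divisorClassesSpan_inducedCMType`), `SimpleIffPrimitiveCMType`
(`isSimple_iff_isPrimitive`), `PrimitiveCMTypeSimple` (`isPrimitive_ringEquiv_complex_iff`), `CMTypeRankCharactersNumberField`
(`embOf`, `embOf_bijective`, `card_gal_eq_finrank`), `DegenerateCMTypesCyclicTwoOddPrimes` (`isCMTypeWith_galType`,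
`cmTypeRank_eq_typeRank_galType`), Mathlib `IntermediateField.finrank_fixedField_eq_card`.
-/

open scoped BigOperators NumberField IsMulCommutative Classical
open NumberField Module CategoryTheory CategoryTheory.Limits IntermediateField

namespace Literature.AlgebraicGeometry.Pohlmann1968

namespace Multiquadratic

-- `open scoped`: the tree's action of `Aut(ℂ)` on `Hom(K, ℂ)` by composition is a scoped instance
open scoped Literature.NumberTheory.ComplexMultiplication
open Literature.NumberTheory.ComplexMultiplication (IsPrimitive inducedCMType typeRank mem_inducedCMType_iff
  exists_inducedCMType_of_twist_eq isCMField_of_cmType_intermediateField twistStabilizer mem_twistStabilizer_iff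
  exists_eq_inducedCMType_fixedField_of_le_twistStabilizer pattern_primitive_iff_twistStabilizer_eq_bot conjGal
  conjGal_mul_conjGal)
open Literature.NumberTheory.ComplexMultiplication.CMNumbers
open Literature.AlgebraicGeometry.Motives (CMType AbelianVariety)
open Literature.AlgebraicGeometry.HodgeTheory
open Literature.AlgebraicGeometry.VanGeemen1994 (hodgeClassSpan)
open Literature.Barriers.HodgeConjecture (divisorClassesSpan)
open Literature.AlgebraicGeometry.ComplexMultiplication (IsCMTypeRealisation isSimple_iff_isPrimitive
  isPrimitive_ringEquiv_complex_iff)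
open Literature.AlgebraicGeometry.Pohlmann1968.CyclicTwoOddPrimes (isCMTypeWith_galType cmTypeRank_eq_typeRank_galType)
open Literature.AlgebraicGeometry.Pohlmann1968.AbelianKernels

variable {K : Type} [Field K] [NumberField K] [IsCMField K] [IsGalois ℚ K]
  {A : AbelianVariety ℂ} {ι : 𝓞 K →+* End A} {θ : K →+* Module.End ℂ (complexBetti A.X 1)}

/-! ## §0 Helpers and the dictionary -/

section Helpers

/-- A group of exponent `2` is commutative. [folklore] -/
private theorem mul_comm_of_sq_eq_one_r {G : Type*} [Group G] (hexp : ∀ g : G, g ^ 2 = 1) (a b : G) :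
    a * b = b * a := by
  have hinv : ∀ x : G, x⁻¹ = x := fun x => inv_eq_of_mul_eq_one_right (by rw [← pow_two]; exact hexp x)
  calc a * b = (a * b)⁻¹ := (hinv _).symm
    _ = b⁻¹ * a⁻¹ := mul_inv_rev a b
    _ = b * a := by rw [hinv, hinv]

omit [IsCMField K] in
/-- A Galois extension whose Galois group has exponent `2` is abelian (the Galois group of a multiquadratic field is
an elementary abelian `2`-group). [cite: Dodson1984, §3.1.1] -/
theorem isAbelianGalois_of_forall_sq_eq_one (hexp : ∀ g : K ≃ₐ[ℚ] K, g ^ 2 = 1) : IsAbelianGalois ℚ K :=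
  { is_comm.comm := mul_comm_of_sq_eq_one_r hexp }

omit [IsCMField K] [IsGalois ℚ K] in
/-- `σ_{ht} = σ_t ∘ h` for `h² = 1` (`σ_g = φ₀ ∘ g⁻¹`). [folklore] -/
private theorem embOf_mul_eq_comp_r (hexp : ∀ g : K ≃ₐ[ℚ] K, g ^ 2 = 1) (φ₀ : K →+* ℂ) (h t : K ≃ₐ[ℚ] K) :
    embOf φ₀ (h * t) = (embOf φ₀ t).comp (h : K →+* K) := by
  have hh : ∀ x : K, h (h x) = x := fun x => by
    have := AlgEquiv.congr_fun (show h * h = 1 by rw [← pow_two]; exact hexp h) x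
    rwa [AlgEquiv.mul_apply, AlgEquiv.one_apply] at this
  refine RingHom.ext fun x => ?_
  rw [RingHom.comp_apply, embOf_apply, embOf_apply]
  congr 1
  rw [AlgEquiv.symm_apply_eq, AlgEquiv.mul_apply, AlgEquiv.apply_symm_apply]
  exact (hh x).symm

omit [IsCMField K] [IsGalois ℚ K] in
/-- `g.symm = g` for `g² = 1`. [folklore] -/
private theorem symm_eq_self_of_sq_r (hexp : ∀ g : K ≃ₐ[ℚ] K, g ^ 2 = 1) (g : K ≃ₐ[ℚ] K) : g.symm = g := by
  rw [← AlgEquiv.aut_inv]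
  exact inv_eq_of_mul_eq_one_right (by rw [← pow_two]; exact hexp g)

omit [IsCMField K] [IsGalois ℚ K] in
/-- `Φg = Φ` on embeddings ⟹ `g ∈ Stab(Φ)` (the tree's twist stabiliser; `g² = 1`). [cite: BCLLMNO2015, §3 Prop. 3.3] -/
theorem mem_twistStabilizer_of_comp_mem_iff (hexp : ∀ g : K ≃ₐ[ℚ] K, g ^ 2 = 1) (Φ : CMType K)
    {g : K ≃ₐ[ℚ] K} (hstab : ∀ φ : K →+* ℂ, φ.comp (g : K →+* K) ∈ Φ.1 ↔ φ ∈ Φ.1) : g ∈ twistStabilizer Φ := by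
  rw [mem_twistStabilizer_iff]
  apply Subtype.ext
  ext φ
  rw [mem_inducedCMType_iff, symm_eq_self_of_sq_r hexp g]
  exact hstab φ

omit [IsCMField K] in
/-- **Dictionary**: a group-level stabilising element (`tg ∈ S ⟺ t ∈ S` on `S = {t : σ_t ∈ Φ}`, `σ_t = φ₀ ∘ t⁻¹`)
stabilises `Φ` on embeddings (`φ ∘ g ∈ Φ ⟺ φ ∈ Φ`), and conversely. [cite: Kubota1965, §4 Lemma 2] [cite: Shimura1998, §8.1] -/
theorem comp_mem_iff_iff_forall_mul_mem_iff (hexp : ∀ g : K ≃ₐ[ℚ] K, g ^ 2 = 1) (φ₀ : K →+* ℂ)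
    (Φ : CMType K) (g : K ≃ₐ[ℚ] K) :
    (∀ φ : K →+* ℂ, φ.comp (g : K →+* K) ∈ Φ.1 ↔ φ ∈ Φ.1) ↔
      ∀ t : K ≃ₐ[ℚ] K, t * g ∈ (Finset.univ.filter fun s : K ≃ₐ[ℚ] K => embOf φ₀ s ∈ Φ.1) ↔
        t ∈ (Finset.univ.filter fun s : K ≃ₐ[ℚ] K => embOf φ₀ s ∈ Φ.1) := by
  haveI : Normal ℚ K := inferInstance
  constructor
  · intro hstab t
    simp only [Finset.mem_filter, Finset.mem_univ, true_and]
    rw [mul_comm_of_sq_eq_one_r hexp t g, embOf_mul_eq_comp_r hexp φ₀ g t]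
    exact hstab _
  · intro hstab φ
    obtain ⟨t, rfl⟩ := (embOf_bijective φ₀).2 φ
    have h1 := hstab t
    simp only [Finset.mem_filter, Finset.mem_univ, true_and] at h1
    rw [← embOf_mul_eq_comp_r hexp φ₀ g t, mul_comm_of_sq_eq_one_r hexp g t]
    exact h1

omit [IsCMField K] [IsGalois ℚ K] in
/-- `Bᵐ ⊗ ℂ = Dᵐ ⊗ ℂ` for all `m` on an abelian variety gives the Hodge conjecture for it (Lefschetz `(1,1)` and cup
products, tree theorems). [cite: Gordon1999HodgeAVSurvey, §9.3] -/
theorem hodgeConjectureFor_of_forall_hodgeClassSpan_eq_divisorClassesSpan (B : AbelianVariety ℂ)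
    (h : ∀ m : ℕ, hodgeClassSpan B.dim B.X m = divisorClassesSpan B.X B.dim m) : HodgeConjectureFor B.dim B.X :=
  ⟨nonempty_hodgeModel_holds (Motives.AbelianVariety.isSmoothProjective_holds (A := B)),
    fun m _ hc hmm => AbelianVariety.divisorClassesSpan_le_algebraicClasses B
      (fun b hb hb' => lefschetzOneOne_rational_holds (Motives.AbelianVariety.isSmoothProjective_holds (A := B)) b hb hb')
      m ((h m) ▸ Submodule.subset_span ⟨hc, hmm⟩)⟩

end Helpers

/-! ## §1 Rank `5`: the stabiliser has order `≥ [K:ℚ]/8`; induced from a nondegenerate octic type -/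

section RankFive

/-- **`Φg = Φ` for some `g ≠ 1` ⟹ `Rank(Φ) ≤ [K:ℚ]/4 + 1`** (every degree: the survivors lie in the characters
trivial at `g`). [cite: Kubota1965, §2 and §4 Lemma 2] -/
theorem cmTypeRank_le_of_comp_mem_iff (hexp : ∀ g : K ≃ₐ[ℚ] K, g ^ 2 = 1) (Φ : CMType K) {g : K ≃ₐ[ℚ] K}
    (hg1 : g ≠ 1) (hstab : ∀ φ : K →+* ℂ, φ.comp (g : K →+* K) ∈ Φ.1 ↔ φ ∈ Φ.1) :
    cmTypeRank Φ ≤ finrank ℚ K / 4 + 1 := by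
  haveI := isAbelianGalois_of_forall_sq_eq_one hexp
  obtain ⟨φ₀⟩ := (inferInstance : Nonempty (K →+* ℂ))
  have hcm := isCMTypeWith_galType (AbelianCMFieldExistence.apply_conjGal_eq φ₀) Φ
  rw [cmTypeRank_eq_typeRank_galType Φ φ₀, ← card_gal_eq_finrank φ₀]
  exact Literature.NumberTheory.ComplexMultiplication.CyclicCMType.ExponentTwo.typeRank_le_of_forall_mul_mem_iff hexp
    hcm hg1 ((comp_mem_iff_iff_forall_mul_mem_iff hexp φ₀ Φ g).1 hstab)


/-- **RANK `5` ⟹ `[K:ℚ] ≤ 8·|Stab(Φ)|`, multiquadratic `K` of EVERY degree** (the group-level joint kernel of the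
three independent survivors, tree `card_le_eight_mul_card_filter_forall_mul_mem_iff_of_typeRank_eq_five`, read in
the twist stabiliser through the dictionary `Φg = Φ ⟺ tg ∈ S ⟺ t ∈ S`). [cite: Kubota1965, §2 and §4 Lemma 2]
[cite: BCLLMNO2015, §3 Prop. 3.3] -/
theorem finrank_le_eight_mul_natCard_twistStabilizer_of_cmTypeRank_eq_five (hexp : ∀ g : K ≃ₐ[ℚ] K, g ^ 2 = 1)
    (Φ : CMType K) (hr : cmTypeRank Φ = 5) : finrank ℚ K ≤ 8 * Nat.card (twistStabilizer Φ) := by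
  haveI := isAbelianGalois_of_forall_sq_eq_one hexp
  obtain ⟨φ₀⟩ := (inferInstance : Nonempty (K →+* ℂ))
  have hcm := isCMTypeWith_galType (AbelianCMFieldExistence.apply_conjGal_eq φ₀) Φ
  have hr' : typeRank (K ≃ₐ[ℚ] K)
      (↑(Finset.univ.filter fun g : K ≃ₐ[ℚ] K => embOf φ₀ g ∈ Φ.1) : Set (K ≃ₐ[ℚ] K)) = 5 := by
    rw [← cmTypeRank_eq_typeRank_galType Φ φ₀, hr]
  have h8 :=
    Literature.NumberTheory.ComplexMultiplication.CyclicCMType.ExponentTwo.card_le_eight_mul_card_filter_forall_mul_mem_iff_of_typeRank_eq_five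
      hexp hcm hr'
  have hsub : (↑(Finset.univ.filter fun g : K ≃ₐ[ℚ] K => ∀ t : K ≃ₐ[ℚ] K,
      t * g ∈ (Finset.univ.filter fun s : K ≃ₐ[ℚ] K => embOf φ₀ s ∈ Φ.1) ↔
        t ∈ (Finset.univ.filter fun s : K ≃ₐ[ℚ] K => embOf φ₀ s ∈ Φ.1)) : Set (K ≃ₐ[ℚ] K)) ⊆
      (twistStabilizer Φ : Set (K ≃ₐ[ℚ] K)) := by
    intro g hg
    rw [Finset.coe_filter, Set.mem_setOf_eq] at hg
    exact mem_twistStabilizer_of_comp_mem_iff hexp Φ ((comp_mem_iff_iff_forall_mul_mem_iff hexp φ₀ Φ g).2 hg.2)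
  have h1 := Set.ncard_le_ncard hsub
  rw [Set.ncard_coe_finset, ← Nat.card_coe_set_eq] at h1
  rw [← card_gal_eq_finrank φ₀]
  exact h8.trans (Nat.mul_le_mul_left 8 h1)

/-- **RANK `5` ⟹ the fixed field of `Stab(Φ)` is OCTIC** (`[K^{Stab}:ℚ] = [K:ℚ]/|Stab(Φ)| ≤ 8`, and `Φ` is
induced from a type `Ψ` of it with `5 = Rank(Ψ) ≤ [K^{Stab}:ℚ]/2 + 1`). [cite: Lang1983ComplexMultiplication, Ch. I Thm. 3.6]
[cite: Kubota1965, §2 and §4 Lemma 2] -/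
theorem finrank_fixedField_twistStabilizer_eq_eight_of_cmTypeRank_eq_five (hexp : ∀ g : K ≃ₐ[ℚ] K, g ^ 2 = 1)
    (Φ : CMType K) (hr : cmTypeRank Φ = 5) : finrank ℚ (fixedField (twistStabilizer Φ)) = 8 := by
  have hcard := finrank_le_eight_mul_natCard_twistStabilizer_of_cmTypeRank_eq_five hexp Φ hr
  obtain ⟨Ψ, hΨ⟩ := exists_eq_inducedCMType_fixedField_of_le_twistStabilizer (le_refl (twistStabilizer Φ))
  haveI hCM : IsCMField (fixedField (twistStabilizer Φ)) :=
    isCMField_of_cmType_intermediateField (fixedField (twistStabilizer Φ)) Ψ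
  have hrΨ : cmTypeRank Ψ = 5 := by
    rw [← cmTypeRank_inducedCMType (algebraMap (fixedField (twistStabilizer Φ)) K) Ψ, hΨ, hr]
  have hle : cmTypeRank Ψ ≤ finrank ℚ (fixedField (twistStabilizer Φ)) / 2 + 1 := cmTypeRank_le Ψ
  have hmul : finrank ℚ (fixedField (twistStabilizer Φ)) * finrank (fixedField (twistStabilizer Φ)) K =
      finrank ℚ K := Module.finrank_mul_finrank ℚ (fixedField (twistStabilizer Φ)) K
  have hkK : finrank (fixedField (twistStabilizer Φ)) K = Nat.card (twistStabilizer Φ) :=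
    IntermediateField.finrank_fixedField_eq_card (twistStabilizer Φ)
  have hF : 0 < finrank ℚ K := Module.finrank_pos
  rw [hkK] at hmul
  rw [hrΨ] at hle
  have hge : 8 ≤ finrank ℚ (fixedField (twistStabilizer Φ)) := by omega
  have hpos : 0 < Nat.card (twistStabilizer Φ) := by
    rcases Nat.eq_zero_or_pos (Nat.card (twistStabilizer Φ)) with h0 | h0
    · rw [h0, mul_zero] at hmul; omega
    · exact h0
  have hle8 : finrank ℚ (fixedField (twistStabilizer Φ)) ≤ 8 := by nlinarith
  omega

/-- **RANK `5` ⟹ `[K:ℚ] = 8·|Stab(Φ)|`** (multiquadratic `K` of every degree): the stabiliser of a rank-`5` type has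
index exactly `8`. [cite: Kubota1965, §2 and §4 Lemma 2] [cite: BCLLMNO2015, §3 Prop. 3.3] -/
theorem finrank_eq_eight_mul_natCard_twistStabilizer_of_cmTypeRank_eq_five (hexp : ∀ g : K ≃ₐ[ℚ] K, g ^ 2 = 1)
    (Φ : CMType K) (hr : cmTypeRank Φ = 5) : finrank ℚ K = 8 * Nat.card (twistStabilizer Φ) := by
  rw [← finrank_fixedField_twistStabilizer_eq_eight_of_cmTypeRank_eq_five hexp Φ hr,
    ← IntermediateField.finrank_fixedField_eq_card (twistStabilizer Φ)]
  exact (Module.finrank_mul_finrank ℚ (fixedField (twistStabilizer Φ)) K).symm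

/-- **RANK `5` ⟹ `Φ = Ψ^K` FOR A NONDEGENERATE CM TYPE `Ψ` OF AN OCTIC SUBFIELD — multiquadratic `K` of EVERY
degree**: `Φ` is induced from the fixed field `k` of its stabiliser, `[k:ℚ] = 8`, and `5 = Rank(Ψ) = [k:ℚ]/2 + 1`
is full rank (so `Ψ` is primitive and its abelian fourfolds are simple).
[cite: Lang1983ComplexMultiplication, Ch. I Thm. 3.6] [cite: BCLLMNO2015, §3 Prop. 3.3] [cite: Kubota1965, §4 Lemma 2] -/
theorem exists_inducedCMType_octic_isNondegenerate_of_cmTypeRank_eq_five (hexp : ∀ g : K ≃ₐ[ℚ] K, g ^ 2 = 1)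
    (Φ : CMType K) (hr : cmTypeRank Φ = 5) :
    ∃ (k : IntermediateField ℚ K) (Ψ : CMType k), finrank ℚ k = 8 ∧ inducedCMType (algebraMap k K) Ψ = Φ ∧
      ∃ _ : IsCMField k, IsNondegenerate Ψ := by
  have h8 := finrank_fixedField_twistStabilizer_eq_eight_of_cmTypeRank_eq_five hexp Φ hr
  obtain ⟨Ψ, hΨ⟩ := exists_eq_inducedCMType_fixedField_of_le_twistStabilizer (le_refl (twistStabilizer Φ))
  haveI hCM : IsCMField (fixedField (twistStabilizer Φ)) :=
    isCMField_of_cmType_intermediateField (fixedField (twistStabilizer Φ)) Ψ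
  have hrΨ : cmTypeRank Ψ = 5 := by
    rw [← cmTypeRank_inducedCMType (algebraMap (fixedField (twistStabilizer Φ)) K) Ψ, hΨ, hr]
  refine ⟨fixedField (twistStabilizer Φ), Ψ, h8, hΨ, hCM, ?_⟩
  rw [_root_.Literature.AlgebraicGeometry.Pohlmann1968.isNondegenerate_iff, h8, hrΨ]

/-- **RANK `5` AND `[K:ℚ] ≥ 16` ⟹ `Φ` IS NOT PRIMITIVE** (its stabiliser has order `≥ [K:ℚ]/8 ≥ 2`).
[cite: Shimura1998, §8.2 Prop. 26 and §8.4 Example (1)] [cite: Kubota1965, §4 Lemma 2] -/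
theorem not_isPrimitive_of_cmTypeRank_eq_five_of_sixteen_le (hexp : ∀ g : K ≃ₐ[ℚ] K, g ^ 2 = 1)
    (h16 : 16 ≤ finrank ℚ K) (Φ : CMType K) (φ₀ : K →+* ℂ) (hr : cmTypeRank Φ = 5) :
    ¬ IsPrimitive (ℂ ≃+* ℂ) Φ.1 φ₀ := by
  have hcard := finrank_le_eight_mul_natCard_twistStabilizer_of_cmTypeRank_eq_five hexp Φ hr
  rw [isPrimitive_ringEquiv_complex_iff, pattern_primitive_iff_twistStabilizer_eq_bot]
  intro hbot
  rw [hbot, Subgroup.card_bot] at hcard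
  omega


/-- **RANK `5` AND `[K:ℚ] ≥ 16` ⟹ `Φg = Φ` FOR SOME `g ≠ 1`** (group level: `|Stab| ≥ |G|/8 ≥ 2`).
[cite: Kubota1965, §2 and §4 Lemma 2] -/
theorem exists_ne_one_comp_mem_iff_of_cmTypeRank_eq_five_of_sixteen_le (hexp : ∀ g : K ≃ₐ[ℚ] K, g ^ 2 = 1)
    (h16 : 16 ≤ finrank ℚ K) (Φ : CMType K) (hr : cmTypeRank Φ = 5) :
    ∃ g : K ≃ₐ[ℚ] K, g ≠ 1 ∧ ∀ φ : K →+* ℂ, φ.comp (g : K →+* K) ∈ Φ.1 ↔ φ ∈ Φ.1 := by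
  haveI := isAbelianGalois_of_forall_sq_eq_one hexp
  obtain ⟨φ₀⟩ := (inferInstance : Nonempty (K →+* ℂ))
  have hcm := isCMTypeWith_galType (AbelianCMFieldExistence.apply_conjGal_eq φ₀) Φ
  have hr' : typeRank (K ≃ₐ[ℚ] K)
      (↑(Finset.univ.filter fun g : K ≃ₐ[ℚ] K => embOf φ₀ g ∈ Φ.1) : Set (K ≃ₐ[ℚ] K)) = 5 := by
    rw [← cmTypeRank_eq_typeRank_galType Φ φ₀, hr]
  obtain ⟨g, hg1, hstab⟩ :=
    Literature.NumberTheory.ComplexMultiplication.CyclicCMType.ExponentTwo.exists_ne_one_forall_mul_mem_iff_of_typeRank_eq_five_of_le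
      hexp hcm (by rw [card_gal_eq_finrank φ₀]; exact h16) hr'
  exact ⟨g, hg1, (comp_mem_iff_iff_forall_mul_mem_iff hexp φ₀ Φ g).2 hstab⟩

/-- **RANK `5` AND `[K:ℚ] ≥ 16` ⟹ THE ABELIAN VARIETIES OF TYPE `(K; Φ)` ARE NOT SIMPLE** (simple ⟺ primitive,
tree `isSimple_iff_isPrimitive`). [cite: Shimura1998, §8.2 Prop. 26] [cite: Kubota1965, §4 Lemma 2] -/
theorem not_isSimple_of_cmTypeRank_eq_five_of_sixteen_le (hexp : ∀ g : K ≃ₐ[ℚ] K, g ^ 2 = 1)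
    (h16 : 16 ≤ finrank ℚ K) (Φ : CMType K) (hr : cmTypeRank Φ = 5) (hA : IsCMTypeRealisation Φ A ι θ) :
    ¬ A.IsSimple := by
  obtain ⟨φ₀⟩ : Nonempty (K →+* ℂ) := inferInstance
  rw [isSimple_iff_isPrimitive hA φ₀]
  exact not_isPrimitive_of_cmTypeRank_eq_five_of_sixteen_le hexp h16 Φ φ₀ hr

end RankFive

/-! ## §2 The Hodge conjecture for every power -/

section Hodge

/-- **`Bᵐ(Aⁿ) ⊗ ℂ = Dᵐ(Aⁿ) ⊗ ℂ` FOR ALL `n, m`, FOR EVERY ABELIAN VARIETY WHOSE CM TYPE HAS RANK `5` ON A MULTIQUADRATIC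
CM FIELD OF ANY DEGREE** (induced from a nondegenerate octic type; Pohlmann–Hazama transfer along `Φ = Ψ^K`).
[cite: Gordon1999HodgeAVSurvey, Thm. 6.4 and §9.3] [cite: Kubota1965, §4 Lemma 2] -/
theorem hodgeClassSpan_pow_eq_divisorClassesSpan_of_cmTypeRank_eq_five (hexp : ∀ g : K ≃ₐ[ℚ] K, g ^ 2 = 1)
    (Φ : CMType K) (hr : cmTypeRank Φ = 5) (hA : IsCMTypeRealisation Φ A ι θ) (n m : ℕ) :
    hodgeClassSpan (⨁ fun _ : Fin n => A).dim (⨁ fun _ : Fin n => A).X m =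
      divisorClassesSpan (⨁ fun _ : Fin n => A).X (⨁ fun _ : Fin n => A).dim m := by
  obtain ⟨k, Ψ, -, hΨ, hCM, hnd⟩ := exists_inducedCMType_octic_isNondegenerate_of_cmTypeRank_eq_five hexp Φ hr
  haveI := hCM
  exact hnd.hodgeClassSpan_pow_eq_divisorClassesSpan_inducedCMType hΨ hA n m

/-- **THE HODGE CONJECTURE FOR EVERY POWER OF EVERY ABELIAN VARIETY WHOSE CM TYPE HAS RANK `5`, ON A MULTIQUADRATIC CM
FIELD OF ANY DEGREE** (every realisation `(A, ι, θ)`, every `n`). [cite: Gordon1999HodgeAVSurvey, Thm. 6.4 and §9.3]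
[cite: Kubota1965, §4 Lemma 2] -/
theorem hodgeConjectureFor_pow_of_cmTypeRank_eq_five (hexp : ∀ g : K ≃ₐ[ℚ] K, g ^ 2 = 1) (Φ : CMType K)
    (hr : cmTypeRank Φ = 5) (hA : IsCMTypeRealisation Φ A ι θ) (n : ℕ) :
    HodgeConjectureFor (⨁ fun _ : Fin n => A).dim (⨁ fun _ : Fin n => A).X :=
  hodgeConjectureFor_of_forall_hodgeClassSpan_eq_divisorClassesSpan _
    (fun m => hodgeClassSpan_pow_eq_divisorClassesSpan_of_cmTypeRank_eq_five hexp Φ hr hA n m)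

/-- **Every Hodge class on every power is algebraic** (`Rank(Φ) = 5`, any degree). [cite: Gordon1999HodgeAVSurvey, Thm. 6.4 and §9.3] -/
theorem hodgeClasses_algebraic_pow_of_cmTypeRank_eq_five (hexp : ∀ g : K ≃ₐ[ℚ] K, g ^ 2 = 1) (Φ : CMType K)
    (hr : cmTypeRank Φ = 5) (hA : IsCMTypeRealisation Φ A ι θ) (n m : ℕ)
    (c : complexBetti (⨁ fun _ : Fin n => A).X (2 * m)) (hcQ : IsRationalClass c)
    (hcH : IsOfHodgeType (⨁ fun _ : Fin n => A).dim (⨁ fun _ : Fin n => A).X (2 * m) m m c) :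
    c ∈ algebraicClasses (⨁ fun _ : Fin n => A).X m :=
  (hodgeConjectureFor_pow_of_cmTypeRank_eq_five hexp Φ hr hA n).2 m c hcQ hcH

/-- **No power carries an exceptional Hodge class** (`Rank(Φ) = 5`, any degree). [cite: Gordon1999HodgeAVSurvey, Thm. 6.4 and §9.3] -/
theorem not_exists_exceptional_pow_of_cmTypeRank_eq_five (hexp : ∀ g : K ≃ₐ[ℚ] K, g ^ 2 = 1) (Φ : CMType K)
    (hr : cmTypeRank Φ = 5) (hA : IsCMTypeRealisation Φ A ι θ) (n m : ℕ) :
    ¬ ∃ c : complexBetti (⨁ fun _ : Fin n => A).X (2 * m), IsRationalClass c ∧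
        IsOfHodgeType (⨁ fun _ : Fin n => A).dim (⨁ fun _ : Fin n => A).X (2 * m) m m c ∧
        c ∉ divisorClassesSpan (⨁ fun _ : Fin n => A).X (⨁ fun _ : Fin n => A).dim m := by
  rintro ⟨c, hcQ, hcH, hcD⟩
  exact hcD ((hodgeClassSpan_pow_eq_divisorClassesSpan_of_cmTypeRank_eq_five hexp Φ hr hA n m) ▸
    Submodule.subset_span ⟨hcQ, hcH⟩)

end Hodge

end Multiquadratic

end Literature.AlgebraicGeometry.Pohlmann1968
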